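import Summits.CriticalPhenomena.Ising3DConformalLimit.Theorems.MoebiusLimitExists.Negative.AsympEquicontinuity
import Summits.CriticalPhenomena.Ising3DConformalLimit.Theses.PerfectScreening
import HarnessLib

/-!
# Tightness of the three RESIDUAL stubs of line `only-interaction-breaks-moebius` (skeleton v3)

Crux `MoebiusLimitExists` = `EnergyNotSigmaSquared.MoebiusLimit` (item stmt-CriticalPhenomena-1344), line
`Cruxes/MoebiusLimitExists/Lines/only-interaction-breaks-moebius.lean`, skeleton v3 (lead
prover-line-stmt-CriticalPhenomena-1344-0, 2026-08-16T02:39Z, sha256[:12] `a43eb29c036c`): after the lead's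
reshapes the ONLY open stubs are the three residues at even orders `2m`, `m ≥ 2`,

* `stub_equicontinuity_ge_four` (1″) — asymptotic equicontinuity of the pinned `2m`-point zoom,
* `stub_interactingInversion_ge_four` (5′) — inversion identity for interacting regular cluster points,
* `stub_interactingUnique_ge_four` (6′) — uniqueness anchored at an interacting cluster point.

Refuter's certificate (drefute gen-5): EACH RESIDUE IS IMPLIED BY THE CRUX, verbatim
(`residues_of_crux`), so none of them can be refuted short of refuting the crux itself; and the
hypothesis-minimal forms record which hypotheses are decorative modulo the crux:

* 1″ holds at ALL orders `n` and WITHOUT the two-point-law data `(Δ, c, hc, hG)` of item 0634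
  (`AsympEquicontinuityTight.pinnedZoom_asympEquicontinuous_of_crux`, gen-4, re-used);
* 5′ needs only `IsClusterPoint S` and the two-point law (to pin `Δ`): `IsRegular S` (normalisation,
  continuity, translation invariance), `HasNontrivialU4 S` and `2 ≤ m` are decorative — in contrast with
  the former STUB 5 (`IsInversionCovariant Δ S` at ALL configurations), where normalisation was needed off
  `NonCoincident` (`PinnedClusterPoints.stub5_of_crux`); even the two-point law can be traded for the
  witness's exponent (`exists_delta_inversion_of_crux`);
* 6′ needs only the two `IsClusterPoint` hypotheses (`PinnedClusterPoints.stub6_of_crux`, gen-0, re-used).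

Conversely the skeleton proves `0634 ∧ 1″ ∧ 5′ ∧ 6′ → crux` (kernel-checked modulo the three `sorry`s),
so GIVEN item 0634 the residue set is EQUIVALENT to the crux. Mechanism of all three certificates: every
cluster point of the pinned zoom is `aⁿ S'ₙ` on `NonCoincident` for ANY non-degenerate limit witness
`(ρ, S')` (`PinnedClusterPoints.clusterPoint_eq`), and the inversion image of a non-coincident
configuration is non-coincident.
-/

noncomputable section

open Filter Topology Set Function EuclideanGeometry
open Literature.Probability.LatticeModels
open Summit.CriticalPhenomena.Ising3DConformalLimit.MoebiusLimitExistsOnlyInteraction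
open Summit.CriticalPhenomena.Ising3DConformalLimit.PinnedClusterPoints
open Summit.CriticalPhenomena.Ising3DConformalLimit.AsympEquicontinuityTight

namespace Summit.CriticalPhenomena.Ising3DConformalLimit.ResiduesTight

/-- **crux ⇒ STUB 1″ verbatim** (`stub_equicontinuity_ge_four` of skeleton v3): the two-point-law data
`(Δ, c)` and the restriction to even orders `≥ 4` are not used. [folklore] -/
theorem stub_equicontinuity_ge_four_of_crux
    (h : Summit.CriticalPhenomena.Ising3DConformalLimit.Theses.EnergyNotSigmaSquared.MoebiusLimit) :
    ∀ (Δ c : ℝ), 0 < c →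
      Tendsto (fun y : Site 3 => criticalTwoPoint 3 y * Real.sqrt (∑ i, ((y i : ℝ)) ^ 2) ^ (2 * Δ))
        cofinite (𝓝 c) →
      ∀ u : ℕ → ℝ, Tendsto u atTop (𝓝[>] (0 : ℝ)) →
        ∀ m : ℕ, 2 ≤ m →
          ∀ (K : Set (Fin (2 * m) → EuclideanSpace ℝ (Fin 3))), IsCompact K → K ⊆ NonCoincident 3 (2 * m) →
            ∀ ε > 0, ∃ η > 0, ∀ᶠ k in atTop, ∀ x ∈ K, ∀ y ∈ K, dist x y < η →
              |rescaledCorrelator (criticalCorr 3) rhoPin (2 * m) (u k) x -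
                rescaledCorrelator (criticalCorr 3) rhoPin (2 * m) (u k) y| < ε :=
  fun _ _ _ _ u hu m _ K hK hKs ε hε =>
    pinnedZoom_asympEquicontinuous_of_crux h u hu (2 * m) K hK hKs ε hε

/-- The unit inversion preserves non-coincidence of configurations (it is injective). [folklore] -/
theorem inversion_comp_mem_nonCoincident {n : ℕ} {x : Fin n → EuclideanSpace ℝ (Fin 3)}
    (hx : x ∈ NonCoincident 3 n) :
    (fun i => inversion (0 : EuclideanSpace ℝ (Fin 3)) 1 (x i)) ∈ NonCoincident 3 n := by
  rw [mem_nonCoincident] at hx ⊢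
  exact ((inversion_injective _ one_ne_zero).of_comp_iff x).2 hx

/-- **crux ⇒ STUB 5′, hypothesis-minimal form**: under the crux, EVERY cluster point of the pinned zoom
whose two-point function is `‖x₀−x₁‖^{-2Δ}` satisfies the inversion identity with weight `Δ` at every
order and every non-coincident configuration avoiding the origin — no normalisation, continuity,
translation invariance, interaction or order restriction. [folklore] -/
theorem inversion_of_clusterPoint_of_crux
    (h : Summit.CriticalPhenomena.Ising3DConformalLimit.Theses.EnergyNotSigmaSquared.MoebiusLimit) :
    ∀ (Δ : ℝ) (S : CorrFamily 3), IsClusterPoint S →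
      (∀ x ∈ NonCoincident 3 2, S 2 x = ‖x 0 - x 1‖ ^ (-(2 * Δ))) →
      ∀ n (x : Fin n → EuclideanSpace ℝ (Fin 3)), x ∈ NonCoincident 3 n → (∀ i, x i ≠ 0) →
        S n (fun i => inversion 0 1 (x i)) = (∏ i, ‖x i‖ ^ (2 * Δ)) * S n x := by
  obtain ⟨ρ, Δ', S', hρ, -, hlim, hnd, hmoeb⟩ := h
  intro Δ S hS h2 n x hx hx0
  have hΔ : Δ = Δ' := delta_eq_of_clusterPoint hρ hlim hnd hmoeb.2.1 hS h2
  rw [clusterPoint_eq hρ hlim hnd hS (inversion_comp_mem_nonCoincident hx),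
    clusterPoint_eq hρ hlim hnd hS hx, hmoeb.2.2 n x hx0, hΔ]
  ring

/-- **crux ⇒ inversion covariance of ALL cluster points with ONE exponent** (the two-point law of 5′
only serves to name the exponent): under the crux there is `Δ' > 0` such that every cluster point of the
pinned zoom satisfies the inversion identity with weight `Δ'` on the non-coincident configurations
avoiding the origin. [folklore] -/
theorem exists_delta_inversion_of_crux
    (h : Summit.CriticalPhenomena.Ising3DConformalLimit.Theses.EnergyNotSigmaSquared.MoebiusLimit) :
    ∃ Δ' : ℝ, 0 < Δ' ∧ ∀ S : CorrFamily 3, IsClusterPoint S →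
      ∀ n (x : Fin n → EuclideanSpace ℝ (Fin 3)), x ∈ NonCoincident 3 n → (∀ i, x i ≠ 0) →
        S n (fun i => inversion 0 1 (x i)) = (∏ i, ‖x i‖ ^ (2 * Δ')) * S n x := by
  obtain ⟨ρ, Δ', S', hρ, hΔ', hlim, hnd, hmoeb⟩ := h
  refine ⟨Δ', hΔ', fun S hS n x hx hx0 => ?_⟩
  rw [clusterPoint_eq hρ hlim hnd hS (inversion_comp_mem_nonCoincident hx),
    clusterPoint_eq hρ hlim hnd hS hx, hmoeb.2.2 n x hx0]
  ring

/-- **crux ⇒ STUB 5′ verbatim** (`stub_interactingInversion_ge_four` of skeleton v3). [folklore] -/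
theorem stub_interactingInversion_ge_four_of_crux
    (h : Summit.CriticalPhenomena.Ising3DConformalLimit.Theses.EnergyNotSigmaSquared.MoebiusLimit) :
    ∀ (Δ : ℝ) (S : CorrFamily 3), IsClusterPoint S → MoebiusLimitExistsOnlyInteraction.IsRegular S →
      (∀ x ∈ NonCoincident 3 2, S 2 x = ‖x 0 - x 1‖ ^ (-(2 * Δ))) →
      HasNontrivialU4 S →
      ∀ m : ℕ, 2 ≤ m → ∀ x : Fin (2 * m) → EuclideanSpace ℝ (Fin 3), x ∈ NonCoincident 3 (2 * m) →
        (∀ i, x i ≠ 0) →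
        S (2 * m) (fun i => EuclideanGeometry.inversion 0 1 (x i)) =
          (∏ i, ‖x i‖ ^ (2 * Δ)) * S (2 * m) x :=
  fun Δ S hS _ h2 _ m _ x hx hx0 => inversion_of_clusterPoint_of_crux h Δ S hS h2 (2 * m) x hx hx0

/-- **crux ⇒ STUB 6′ verbatim** (`stub_interactingUnique_ge_four` of skeleton v3): only the two
`IsClusterPoint` hypotheses are used (`PinnedClusterPoints.stub6_of_crux`). [folklore] -/
theorem stub_interactingUnique_ge_four_of_crux
    (h : Summit.CriticalPhenomena.Ising3DConformalLimit.Theses.EnergyNotSigmaSquared.MoebiusLimit) :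
    ∀ (Δ : ℝ) (S₁ S₂ : CorrFamily 3), IsClusterPoint S₁ → IsClusterPoint S₂ →
      MoebiusLimitExistsOnlyInteraction.IsRegular S₁ → MoebiusLimitExistsOnlyInteraction.IsRegular S₂ →
      (∀ x ∈ NonCoincident 3 2, S₁ 2 x = ‖x 0 - x 1‖ ^ (-(2 * Δ))) →
      (∀ x ∈ NonCoincident 3 2, S₂ 2 x = ‖x 0 - x 1‖ ^ (-(2 * Δ))) →
      HasNontrivialU4 S₁ → ∀ m : ℕ, 2 ≤ m → (NonCoincident 3 (2 * m)).EqOn (S₁ (2 * m)) (S₂ (2 * m)) :=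
  fun _ S₁ S₂ h₁ h₂ _ _ _ _ _ m _ => stub6_of_crux h S₁ S₂ h₁ h₂ (2 * m)

/-- **THE CERTIFICATE: crux ⇒ (1″ ∧ 5′ ∧ 6′) verbatim.** Together with the skeleton's
`MoebiusLimitExists_of` (item 0634 ∧ 1″ ∧ 5′ ∧ 6′ ⇒ crux) the residue set of skeleton v3 is equivalent
to the crux given item 0634; in particular no residue is refutable without refuting the crux. [folklore] -/
theorem residues_of_crux
    (h : Summit.CriticalPhenomena.Ising3DConformalLimit.Theses.EnergyNotSigmaSquared.MoebiusLimit) :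
    (∀ (Δ c : ℝ), 0 < c →
      Tendsto (fun y : Site 3 => criticalTwoPoint 3 y * Real.sqrt (∑ i, ((y i : ℝ)) ^ 2) ^ (2 * Δ))
        cofinite (𝓝 c) →
      ∀ u : ℕ → ℝ, Tendsto u atTop (𝓝[>] (0 : ℝ)) →
        ∀ m : ℕ, 2 ≤ m →
          ∀ (K : Set (Fin (2 * m) → EuclideanSpace ℝ (Fin 3))), IsCompact K → K ⊆ NonCoincident 3 (2 * m) →
            ∀ ε > 0, ∃ η > 0, ∀ᶠ k in atTop, ∀ x ∈ K, ∀ y ∈ K, dist x y < η →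
              |rescaledCorrelator (criticalCorr 3) rhoPin (2 * m) (u k) x -
                rescaledCorrelator (criticalCorr 3) rhoPin (2 * m) (u k) y| < ε) ∧
    (∀ (Δ : ℝ) (S : CorrFamily 3), IsClusterPoint S → MoebiusLimitExistsOnlyInteraction.IsRegular S →
      (∀ x ∈ NonCoincident 3 2, S 2 x = ‖x 0 - x 1‖ ^ (-(2 * Δ))) →
      HasNontrivialU4 S →
      ∀ m : ℕ, 2 ≤ m → ∀ x : Fin (2 * m) → EuclideanSpace ℝ (Fin 3), x ∈ NonCoincident 3 (2 * m) →
        (∀ i, x i ≠ 0) →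
        S (2 * m) (fun i => EuclideanGeometry.inversion 0 1 (x i)) =
          (∏ i, ‖x i‖ ^ (2 * Δ)) * S (2 * m) x) ∧
    (∀ (Δ : ℝ) (S₁ S₂ : CorrFamily 3), IsClusterPoint S₁ → IsClusterPoint S₂ →
      MoebiusLimitExistsOnlyInteraction.IsRegular S₁ → MoebiusLimitExistsOnlyInteraction.IsRegular S₂ →
      (∀ x ∈ NonCoincident 3 2, S₁ 2 x = ‖x 0 - x 1‖ ^ (-(2 * Δ))) →
      (∀ x ∈ NonCoincident 3 2, S₂ 2 x = ‖x 0 - x 1‖ ^ (-(2 * Δ))) →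
      HasNontrivialU4 S₁ → ∀ m : ℕ, 2 ≤ m → (NonCoincident 3 (2 * m)).EqOn (S₁ (2 * m)) (S₂ (2 * m))) :=
  ⟨stub_equicontinuity_ge_four_of_crux h, stub_interactingInversion_ge_four_of_crux h,
    stub_interactingUnique_ge_four_of_crux h⟩

/-- The same certificate keyed on the `PerfectScreening.MoebiusLimitExists` spelling of the crux (one
term with `EnergyNotSigmaSquared.MoebiusLimit`). [folklore] -/
theorem residues_of_crux'
    (h : Summit.CriticalPhenomena.Ising3DConformalLimit.Theses.PerfectScreening.MoebiusLimitExists) :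
    (∀ (Δ c : ℝ), 0 < c →
      Tendsto (fun y : Site 3 => criticalTwoPoint 3 y * Real.sqrt (∑ i, ((y i : ℝ)) ^ 2) ^ (2 * Δ))
        cofinite (𝓝 c) →
      ∀ u : ℕ → ℝ, Tendsto u atTop (𝓝[>] (0 : ℝ)) →
        ∀ m : ℕ, 2 ≤ m →
          ∀ (K : Set (Fin (2 * m) → EuclideanSpace ℝ (Fin 3))), IsCompact K → K ⊆ NonCoincident 3 (2 * m) →
            ∀ ε > 0, ∃ η > 0, ∀ᶠ k in atTop, ∀ x ∈ K, ∀ y ∈ K, dist x y < η →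
              |rescaledCorrelator (criticalCorr 3) rhoPin (2 * m) (u k) x -
                rescaledCorrelator (criticalCorr 3) rhoPin (2 * m) (u k) y| < ε) ∧
    (∀ (Δ : ℝ) (S : CorrFamily 3), IsClusterPoint S → MoebiusLimitExistsOnlyInteraction.IsRegular S →
      (∀ x ∈ NonCoincident 3 2, S 2 x = ‖x 0 - x 1‖ ^ (-(2 * Δ))) →
      HasNontrivialU4 S →
      ∀ m : ℕ, 2 ≤ m → ∀ x : Fin (2 * m) → EuclideanSpace ℝ (Fin 3), x ∈ NonCoincident 3 (2 * m) →
        (∀ i, x i ≠ 0) →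
        S (2 * m) (fun i => EuclideanGeometry.inversion 0 1 (x i)) =
          (∏ i, ‖x i‖ ^ (2 * Δ)) * S (2 * m) x) ∧
    (∀ (Δ : ℝ) (S₁ S₂ : CorrFamily 3), IsClusterPoint S₁ → IsClusterPoint S₂ →
      MoebiusLimitExistsOnlyInteraction.IsRegular S₁ → MoebiusLimitExistsOnlyInteraction.IsRegular S₂ →
      (∀ x ∈ NonCoincident 3 2, S₁ 2 x = ‖x 0 - x 1‖ ^ (-(2 * Δ))) →
      (∀ x ∈ NonCoincident 3 2, S₂ 2 x = ‖x 0 - x 1‖ ^ (-(2 * Δ))) →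
      HasNontrivialU4 S₁ → ∀ m : ℕ, 2 ≤ m → (NonCoincident 3 (2 * m)).EqOn (S₁ (2 * m)) (S₂ (2 * m))) :=
  residues_of_crux h

end Summit.CriticalPhenomena.Ising3DConformalLimit.ResiduesTight

end
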